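import Summits.CriticalPhenomena.PercolationContinuityZ3.Theorems.PercNearOneGluingNoHeavyLowerTailOneCutFourBlobsSharp
import Literature.Probability.LatticeModels.ProdBernoulliIndependence
import Literature.Probability.Percolation.PercolationEvents
import Literature.Probability.Percolation.PercolationProofs
import HarnessLib

/-!
# `NoHeavyLowerTail` (stmt-CriticalPhenomena-4575), one-cut line — the OBSERVER ONE-CUT bound:
# typed reductions (well-attached / near-centre observers, the two-of-three residual) and the trivial rungs

Support file (route-task line `one-cut-mincut-submodularity`).  For `μ = prodBernoulli w` on `Fin n`, an
observer `o`, a relay set `A`, `N = |{a ∈ A : o ↔ a}|`, `E N = Σ_{a∈A} P(o ↔ a)`.  The ONE-CUT engine of the crux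
(registered stub `stub_oneCut`) bounds the lower tail `P(1 ≤ N < E N/2)` by the worst RELAY–RELAY cut.  This file
isolates the observer-side half of that statement, the

  **OBSERVER ONE-CUT BOUND** (OOC; conjectural):   `P(N < E N / 2) ≤ max_{a ∈ A} P(o ↮ a)`,

equivalently `P(N ≥ E N/2) ≥ min_{a∈A} P(o ↔ a)` ("reaching at least half of the relays, mean-weighted, is at
least as likely as reaching the hardest one"), and its form for a two-point observer SET `O = {o, c}`
(`O ↔ a` = some vertex of `O` is joined to `a`; = the vertex form on the graph with `o, c` identified).
STATUS (numerics in the crux evidence `OBSERVER-ONECUT.md`, kit j039183): no violation in an adversarial exact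
census; tight (equality) exactly on the "gateway" configurations (the hardest relay sits, with a majority of the
relays, behind one edge).  For `|A| = 3` OOC is the cell's open "two-of-three" residual (T⅔) of
`Theorems.oneCut_of_fourBlobs_of_twoOfThree` (`observerOneCut_three_iff`-direction proved here:
`twoOfThree_of_observerOneCut`), so OOC ⇒ the SHARP one-cut bound on every four-blob structure
(`oneCut_fourBlobs_of_observerOneCut`).  The hypothesis is written VERBATIM inside each theorem (no definition,
no named fact); every theorem here is a sorry-free implication or an unconditional small case:

* `observerOneCut_card_le_two` — OOC holds unconditionally for `|A| ≤ 2` (`N < E N/2 ≤ 1` forces `N = 0`).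
* `oneCut_of_observerOneCut_wellAttached` — OOC (vertex form, this graph) ⇒ the conclusion of `stub_oneCut`
  for every observer with `P(o ↮ a) ≤ t` for all `a ∈ A` ("well-attached" observers), constant `1`.
* `oneCut_of_observerOneCut_nearCentre` — OOC (two-point form, this graph) ⇒ for every vertex `c`:
  `P(1 ≤ N < E N/2) ≤ P(o ↮ c) + P(o ↔ c)·s` whenever `P(o ↮ a ∧ c ↮ a) ≤ s` for all `a ∈ A`
  (split on `{o ↔ c}`; on it `N_o = N_{{o,c}}` and `E N_o ≤ E N_{{o,c}}`; Harris for the increasing `{o ↔ c}`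
  and the decreasing `{N_{{o,c}} < θ}`).  With a "centre" `c` (`P(c ↔ a) ≥ s_c` for all `a`) and
  `P(o ↔ c)·s_c ≥ 1 − t` this is `≤ t`: the min-cut-tree picture (observer → centre → relays).
* `twoOfThree_of_observerOneCut`, `oneCut_fourBlobs_of_observerOneCut` — OOC at three relays is (T⅔), hence
  closes the sharp four-blob one-cut bound via the landed `oneCut_of_fourBlobs_of_twoOfThree`.

Unconditionally the tree has the CENTRAL case (`Theorems.oneCut_of_central`: `P(o ↔ a)² ≥ 1 − t` for all `a`,
by Markov); OOC is what upgrades "`√(1−t)`-central" to "`(1−t)`-attached".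
-/

noncomputable section

namespace Summit.CriticalPhenomena.PercolationContinuityZ3.Theorems

open MeasureTheory Set Literature.Probability.LatticeModels Literature.Probability.Percolation
open scoped Classical BigOperators

variable {n : ℕ}

/-! ### Monotonicity of relay counts -/

/-- The relay count of an observer set is monotone in the configuration: more open edges, more relays
joined. [folklore] -/
theorem filter_openConn_or_mono (A : Finset (Fin n)) (o c : Fin n) {ω ω' : BondConfig (Fin n)}
    (h : ω ⊆ ω') :
    (A.filter fun a => ω ∈ openConn o a ∨ ω ∈ openConn c a) ⊆
      (A.filter fun a => ω' ∈ openConn o a ∨ ω' ∈ openConn c a) := by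
  intro a ha
  rw [Finset.mem_filter] at ha ⊢
  refine ⟨ha.1, ?_⟩
  rcases ha.2 with h1 | h1
  · exact Or.inl (isUpperSet_openConn o a h h1)
  · exact Or.inr (isUpperSet_openConn c a h h1)

/-- `{N_{{o,c}} < θ}` is a decreasing event. [folklore] -/
theorem isLowerSet_pairCount_lt (A : Finset (Fin n)) (o c : Fin n) (θ : ℝ) :
    IsLowerSet {ω : BondConfig (Fin n) |
      ((A.filter fun a => ω ∈ openConn o a ∨ ω ∈ openConn c a).card : ℝ) < θ} := by
  intro ω' ω h hω'
  simp only [Set.mem_setOf_eq] at hω' ⊢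
  have : ((A.filter fun a => ω ∈ openConn o a ∨ ω ∈ openConn c a).card : ℝ) ≤
      ((A.filter fun a => ω' ∈ openConn o a ∨ ω' ∈ openConn c a).card : ℝ) := by
    exact_mod_cast Finset.card_le_card (filter_openConn_or_mono A o c h)
  linarith

/-! ### The trivial rungs `|A| ≤ 2` -/

/-- **OOC for at most two relays, unconditionally.**  If `A.card ≤ 2`, `0 ≤ s` and `P(o ↮ a) ≤ s` for all
`a ∈ A`, then `P(N < E N/2) ≤ s`: `E N ≤ 2` gives `{N < E N/2} ⊆ {N = 0} ⊆ {o ↮ a}` for any `a ∈ A`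
(and the event is empty if `A = ∅`). [folklore] -/
theorem observerOneCut_card_le_two (w : Sym2 (Fin n) → unitInterval) (A : Finset (Fin n)) (o : Fin n)
    (s : ℝ) (hA : A.card ≤ 2) (hs : 0 ≤ s)
    (hcut : ∀ a ∈ A, (prodBernoulli w).real (openConn o a : Set (BondConfig (Fin n)))ᶜ ≤ s) :
    (prodBernoulli w).real {ω : BondConfig (Fin n) |
        ((A.filter fun a => ω ∈ openConn o a).card : ℝ) <
          (∑ a ∈ A, (prodBernoulli w).real (openConn o a)) / 2} ≤ s := by
  set μ := prodBernoulli w with hμ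
  have hEN : (∑ a ∈ A, μ.real (openConn o a)) ≤ (A.card : ℝ) := by
    calc (∑ a ∈ A, μ.real (openConn o a)) ≤ ∑ _a ∈ A, (1 : ℝ) :=
          Finset.sum_le_sum fun a _ => measureReal_le_one
      _ = (A.card : ℝ) := by simp
  have hA2 : (A.card : ℝ) ≤ 2 := by exact_mod_cast hA
  by_cases hne : A = ∅
  · have hempty : {ω : BondConfig (Fin n) | ((A.filter fun a => ω ∈ openConn o a).card : ℝ) <
        (∑ a ∈ A, μ.real (openConn o a)) / 2} = ∅ := by
      ext ω; simp [hne]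
    rw [hempty, measureReal_empty]; exact hs
  obtain ⟨b, hb⟩ := Finset.nonempty_iff_ne_empty.2 hne
  -- `{N < E N / 2} ⊆ {N = 0} ⊆ {o ↮ b}`
  have hsub : {ω : BondConfig (Fin n) | ((A.filter fun a => ω ∈ openConn o a).card : ℝ) <
        (∑ a ∈ A, μ.real (openConn o a)) / 2} ⊆ (openConn o b)ᶜ := by
    intro ω hω hob
    simp only [Set.mem_setOf_eq] at hω
    have h1 : 1 ≤ (A.filter fun a => ω ∈ openConn o a).card :=
      Finset.card_pos.2 ⟨b, Finset.mem_filter.2 ⟨hb, hob⟩⟩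
    have h1' : (1 : ℝ) ≤ ((A.filter fun a => ω ∈ openConn o a).card : ℝ) := by exact_mod_cast h1
    linarith
  exact (measureReal_mono hsub (measure_ne_top _ _)).trans (hcut b hb)

/-! ### OOC ⇒ the one-cut bound for well-attached observers -/

/-- **Observer one-cut ⇒ sharp one-cut for well-attached observers.**  Hypothesis (OOC, vertex form, for
the given weighted graph, written verbatim): for every relay set `A`, observer `o` and `s ≥ 0`, if
`P(o ↮ a) ≤ s` for all `a ∈ A` then `P(N < E N/2) ≤ s`.  Conclusion: for every observer `o`, relay set `A`
and `t ≥ 0` with `P(o ↮ a) ≤ t` for all `a ∈ A` ("well attached": the observer is as connected to each relay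
as the relays are to each other in the engine's hypothesis), `P(1 ≤ N ∧ N < E N/2) ≤ t` — the conclusion of
the registered `stub_oneCut`, with constant `1`.  CONDITIONAL on OOC. [folklore] -/
theorem oneCut_of_observerOneCut_wellAttached (w : Sym2 (Fin n) → unitInterval)
    (hOOC : ∀ (A : Finset (Fin n)) (o : Fin n) (s : ℝ), 0 ≤ s →
      (∀ a ∈ A, (prodBernoulli w).real (openConn o a : Set (BondConfig (Fin n)))ᶜ ≤ s) →
      (prodBernoulli w).real {ω : BondConfig (Fin n) |
        ((A.filter fun a => ω ∈ openConn o a).card : ℝ) <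
          (∑ a ∈ A, (prodBernoulli w).real (openConn o a)) / 2} ≤ s)
    (A : Finset (Fin n)) (o : Fin n) (t : ℝ) (ht : 0 ≤ t)
    (hatt : ∀ a ∈ A, (prodBernoulli w).real (openConn o a : Set (BondConfig (Fin n)))ᶜ ≤ t) :
    (prodBernoulli w).real {ω : BondConfig (Fin n) |
        1 ≤ (A.filter fun a => ω ∈ openConn o a).card ∧
        ((A.filter fun a => ω ∈ openConn o a).card : ℝ) <
          (∑ a ∈ A, (prodBernoulli w).real (openConn o a)) / 2} ≤ t :=
  le_trans (measureReal_mono (fun _ hω => hω.2) (measure_ne_top _ _)) (hOOC A o t ht hatt)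

/-! ### OOC (two-point observer) ⇒ the near-centre bound -/

/-- **Observer one-cut for a two-point observer ⇒ the near-centre bound.**  Hypothesis (OOC for the observer
SET `{o, c}`, for the given weighted graph, verbatim): for all `A, o, c, s ≥ 0`, if
`P(o ↮ a ∧ c ↮ a) ≤ s` for all `a ∈ A` then `P(N_{oc} < E N_{oc}/2) ≤ s`, where
`N_{oc} = |{a ∈ A : o ↔ a ∨ c ↔ a}|`, `E N_{oc} = Σ_a P(o ↔ a ∨ c ↔ a)`.  Conclusion: for all `A, o, c` and
`s ≥ 0` with `P(o ↮ a ∧ c ↮ a) ≤ s` for every `a ∈ A`,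
`P(1 ≤ N ∧ N < E N/2) ≤ P(o ↮ c) + P(o ↔ c) · s`.
Proof: on `{o ↔ c}` one has `N = N_{oc}` and `E N ≤ E N_{oc}`, so the event lies in
`{o ↮ c} ∪ ({o ↔ c} ∩ {N_{oc} < E N_{oc}/2})`; Harris (increasing × decreasing) and OOC.  With a centre `c`
(`P(c ↮ a) ≤ 1 − s_c`) and `P(o ↔ c) s_c ≥ 1 − t` the right side is `≤ t`.  CONDITIONAL on OOC. [folklore] -/
theorem oneCut_of_observerOneCut_nearCentre (w : Sym2 (Fin n) → unitInterval)
    (hOOC2 : ∀ (A : Finset (Fin n)) (o c : Fin n) (s : ℝ), 0 ≤ s →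
      (∀ a ∈ A, (prodBernoulli w).real
        ((openConn o a : Set (BondConfig (Fin n)))ᶜ ∩ (openConn c a)ᶜ) ≤ s) →
      (prodBernoulli w).real {ω : BondConfig (Fin n) |
        ((A.filter fun a => ω ∈ openConn o a ∨ ω ∈ openConn c a).card : ℝ) <
          (∑ a ∈ A, (prodBernoulli w).real (openConn o a ∪ openConn c a)) / 2} ≤ s)
    (A : Finset (Fin n)) (o c : Fin n) (s : ℝ) (hs : 0 ≤ s)
    (hcut : ∀ a ∈ A, (prodBernoulli w).real
      ((openConn o a : Set (BondConfig (Fin n)))ᶜ ∩ (openConn c a)ᶜ) ≤ s) :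
    (prodBernoulli w).real {ω : BondConfig (Fin n) |
        1 ≤ (A.filter fun a => ω ∈ openConn o a).card ∧
        ((A.filter fun a => ω ∈ openConn o a).card : ℝ) <
          (∑ a ∈ A, (prodBernoulli w).real (openConn o a)) / 2}
      ≤ (prodBernoulli w).real (openConn o c : Set (BondConfig (Fin n)))ᶜ +
        (prodBernoulli w).real (openConn o c) * s := by
  set μ := prodBernoulli w with hμ
  set m : ℝ := ∑ a ∈ A, μ.real (openConn o a) with hm
  set m2 : ℝ := ∑ a ∈ A, μ.real (openConn o a ∪ openConn c a) with hm2
  set E := {ω : BondConfig (Fin n) | 1 ≤ (A.filter fun a => ω ∈ openConn o a).card ∧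
      ((A.filter fun a => ω ∈ openConn o a).card : ℝ) < m / 2} with hE
  set L := {ω : BondConfig (Fin n) |
      ((A.filter fun a => ω ∈ openConn o a ∨ ω ∈ openConn c a).card : ℝ) < m2 / 2} with hL
  have hmm : m ≤ m2 :=
    Finset.sum_le_sum fun a _ => measureReal_mono Set.subset_union_left (measure_ne_top _ _)
  -- on `{o ↔ c}` the two relay counts agree
  have hfilt : ∀ ω : BondConfig (Fin n), ω ∈ openConn o c →
      (A.filter fun a => ω ∈ openConn o a) =
        (A.filter fun a => ω ∈ openConn o a ∨ ω ∈ openConn c a) := by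
    intro ω hoc
    refine Finset.filter_congr fun a _ => ⟨fun h => Or.inl h, fun h => ?_⟩
    rcases h with h | h
    · exact h
    · exact SimpleGraph.Reachable.trans hoc h
  have hsub : E ⊆ (openConn o c)ᶜ ∪ (openConn o c ∩ L) := by
    intro ω hω
    by_cases hoc : ω ∈ openConn o c
    · refine Or.inr ⟨hoc, ?_⟩
      simp only [hE, hL, Set.mem_setOf_eq] at hω ⊢
      rw [← hfilt ω hoc]
      linarith [hω.2]
    · exact Or.inl hoc
  have hHarris : μ.real (openConn o c ∩ L) ≤ μ.real (openConn o c) * μ.real L :=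
    prodBernoulli_harris_upper_lower w (isUpperSet_openConn o c) (isLowerSet_pairCount_lt A o c _)
      MeasurableSet.of_discrete MeasurableSet.of_discrete
  have hL_le : μ.real L ≤ s := hOOC2 A o c s hs hcut
  calc μ.real E ≤ μ.real ((openConn o c)ᶜ ∪ (openConn o c ∩ L)) := measureReal_mono hsub (measure_ne_top _ _)
    _ ≤ μ.real (openConn o c)ᶜ + μ.real (openConn o c ∩ L) := measureReal_union_le _ _
    _ ≤ μ.real (openConn o c)ᶜ + μ.real (openConn o c) * s := by
        gcongr ?_ + ?_
        · exact le_rfl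
        · exact hHarris.trans (mul_le_mul_of_nonneg_left hL_le measureReal_nonneg)

/-! ### OOC at three relays is the two-of-three residual (T⅔) -/

/-- **OOC ⇒ (T⅔).**  From the observer one-cut bound for three-element relay sets: if
`P(o↔a) + P(o↔b) + P(o↔c) > 2` and `P(o ↮ x) ≤ s` for `x = a, b, c`, then
`P(o misses at least two of a, b, c) ≤ s` (the hypothesis `hT23` of `oneCut_of_fourBlobs_of_twoOfThree`,
verbatim).  For distinct `a, b, c`: `E N > 2` makes `{N ≤ 1} ⊆ {N < E N/2}`; coincident labels reduce to a
single cut.  CONDITIONAL on OOC. [folklore] -/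
theorem twoOfThree_of_observerOneCut (w : Sym2 (Fin n) → unitInterval)
    (hOOC : ∀ (A : Finset (Fin n)) (o : Fin n) (s : ℝ), 0 ≤ s →
      (∀ a ∈ A, (prodBernoulli w).real (openConn o a : Set (BondConfig (Fin n)))ᶜ ≤ s) →
      (prodBernoulli w).real {ω : BondConfig (Fin n) |
        ((A.filter fun a => ω ∈ openConn o a).card : ℝ) <
          (∑ a ∈ A, (prodBernoulli w).real (openConn o a)) / 2} ≤ s) :
    ∀ (o a b c : Fin n) (s : ℝ),
      2 < (prodBernoulli w).real (openConn o a) + (prodBernoulli w).real (openConn o b) +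
          (prodBernoulli w).real (openConn o c) →
      (prodBernoulli w).real (openConn o a)ᶜ ≤ s → (prodBernoulli w).real (openConn o b)ᶜ ≤ s →
      (prodBernoulli w).real (openConn o c)ᶜ ≤ s →
      (prodBernoulli w).real ((((openConn o a)ᶜ ∩ (openConn o b)ᶜ) ∪ ((openConn o a)ᶜ ∩ (openConn o c)ᶜ)) ∪
        ((openConn o b)ᶜ ∩ (openConn o c)ᶜ)) ≤ s := by
  intro o a b c s hsum ha hb hc
  set μ := prodBernoulli w with hμ
  have hs : 0 ≤ s := le_trans measureReal_nonneg ha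
  set T := ((((openConn o a)ᶜ ∩ (openConn o b)ᶜ) ∪ ((openConn o a)ᶜ ∩ (openConn o c)ᶜ)) ∪
        ((openConn o b)ᶜ ∩ (openConn o c)ᶜ) : Set (BondConfig (Fin n))) with hT
  -- coincident labels: the event lies in a single cut
  by_cases hab : a = b
  · subst hab
    have : T ⊆ (openConn o a)ᶜ := by
      intro ω hω; rcases hω with (h | h) | h <;> exact h.1
    exact (measureReal_mono this (measure_ne_top _ _)).trans ha
  by_cases hac : a = c
  · subst hac
    have : T ⊆ (openConn o a)ᶜ := by
      intro ω hω; rcases hω with (h | h) | h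
      · exact h.1
      · exact h.1
      · exact h.2
    exact (measureReal_mono this (measure_ne_top _ _)).trans ha
  by_cases hbc : b = c
  · subst hbc
    have : T ⊆ (openConn o b)ᶜ := by
      intro ω hω; rcases hω with (h | h) | h
      · exact h.2
      · exact h.2
      · exact h.1
    exact (measureReal_mono this (measure_ne_top _ _)).trans hb
  -- distinct labels: `T = {N ≤ 1} ⊆ {N < E N / 2}` for `A = {a, b, c}`
  set A : Finset (Fin n) := {a, b, c} with hA
  have hsumA : (∑ x ∈ A, μ.real (openConn o x)) =
      μ.real (openConn o a) + μ.real (openConn o b) + μ.real (openConn o c) := by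
    rw [hA, Finset.sum_insert (by simp [hab, hac]), Finset.sum_insert (by simp [hbc]),
      Finset.sum_singleton]
    ring
  have hcutA : ∀ x ∈ A, μ.real (openConn o x)ᶜ ≤ s := by
    intro x hx
    rw [hA, Finset.mem_insert, Finset.mem_insert, Finset.mem_singleton] at hx
    rcases hx with rfl | rfl | rfl
    · exact ha
    · exact hb
    · exact hc
  have hsub : T ⊆ {ω : BondConfig (Fin n) | ((A.filter fun x => ω ∈ openConn o x).card : ℝ) <
      (∑ x ∈ A, μ.real (openConn o x)) / 2} := by
    intro ω hω
    simp only [Set.mem_setOf_eq]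
    rw [hsumA]
    -- at least two of the three relays are missed, so at most one is joined
    have hcard : (A.filter fun x => ω ∈ openConn o x).card ≤ 1 := by
      rcases hω with (h | h) | h
      · refine (Finset.card_le_card (show (A.filter fun x => ω ∈ openConn o x) ⊆ {c} from ?_)).trans
          (by simp)
        intro x hx
        rw [Finset.mem_filter, hA, Finset.mem_insert, Finset.mem_insert, Finset.mem_singleton] at hx
        rcases hx with ⟨rfl | rfl | rfl, hx2⟩
        · exact absurd hx2 h.1
        · exact absurd hx2 h.2
        · exact Finset.mem_singleton_self _
      · refine (Finset.card_le_card (show (A.filter fun x => ω ∈ openConn o x) ⊆ {b} from ?_)).trans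
          (by simp)
        intro x hx
        rw [Finset.mem_filter, hA, Finset.mem_insert, Finset.mem_insert, Finset.mem_singleton] at hx
        rcases hx with ⟨rfl | rfl | rfl, hx2⟩
        · exact absurd hx2 h.1
        · exact Finset.mem_singleton_self _
        · exact absurd hx2 h.2
      · refine (Finset.card_le_card (show (A.filter fun x => ω ∈ openConn o x) ⊆ {a} from ?_)).trans
          (by simp)
        intro x hx
        rw [Finset.mem_filter, hA, Finset.mem_insert, Finset.mem_insert, Finset.mem_singleton] at hx
        rcases hx with ⟨rfl | rfl | rfl, hx2⟩
        · exact Finset.mem_singleton_self _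
        · exact absurd hx2 h.1
        · exact absurd hx2 h.2
    have : ((A.filter fun x => ω ∈ openConn o x).card : ℝ) ≤ 1 := by exact_mod_cast hcard
    linarith
  exact (measureReal_mono hsub (measure_ne_top _ _)).trans (hOOC A o s hs hcutA)

/-- **OOC ⇒ the SHARP one-cut bound on every four-blob structure.**  The observer one-cut bound (vertex
form, for the given weighted graph) implies the conclusion of `stub_oneCut` (constant `1`, threshold `E N/2`)
for every relay set carrying a four-blob structure `cls` on `insert o A` (same label ⇒ joined almost surely):
OOC at three relays is (T⅔) (`twoOfThree_of_observerOneCut`), and (T⅔) closes the four-blob residual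
(`oneCut_of_fourBlobs_of_twoOfThree`, landed).  CONDITIONAL on OOC. [folklore] -/
theorem oneCut_fourBlobs_of_observerOneCut (w : Sym2 (Fin n) → unitInterval)
    (hOOC : ∀ (A : Finset (Fin n)) (o : Fin n) (s : ℝ), 0 ≤ s →
      (∀ a ∈ A, (prodBernoulli w).real (openConn o a : Set (BondConfig (Fin n)))ᶜ ≤ s) →
      (prodBernoulli w).real {ω : BondConfig (Fin n) |
        ((A.filter fun a => ω ∈ openConn o a).card : ℝ) <
          (∑ a ∈ A, (prodBernoulli w).real (openConn o a)) / 2} ≤ s)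
    (A : Finset (Fin n)) (o : Fin n) (t : ℝ) (cls : Fin n → Fin 4)
    (hcls : ∀ u ∈ insert o A, ∀ v ∈ insert o A, cls u = cls v →
      (prodBernoulli w).real (openConn u v)ᶜ = 0)
    (ht : 0 ≤ t)
    (hpair : ∀ a ∈ A, ∀ a' ∈ A, a ≠ a' → (prodBernoulli w).real (openConn a a')ᶜ ≤ t) :
    (prodBernoulli w).real {ω : BondConfig (Fin n) |
        1 ≤ (A.filter fun a => ω ∈ openConn o a).card ∧
        ((A.filter fun a => ω ∈ openConn o a).card : ℝ) <
          (∑ a ∈ A, (prodBernoulli w).real (openConn o a)) / 2} ≤ t :=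
  oneCut_of_fourBlobs_of_twoOfThree n w (twoOfThree_of_observerOneCut w hOOC) A o t cls hcls ht hpair

end Summit.CriticalPhenomena.PercolationContinuityZ3.Theorems

end
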